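import Literature.AlgebraicGeometry.Frobenioids.CategoriesMonoMinimalSplitMono
import HarnessLib

/-!
# Frobenioids I, §0 p. 18: split-mono-rigidity is strictly weaker than total epimorphicity (witness)

Mochizuki, *The geometry of Frobenioids I: the general theory*, Kyushu J. Math. **62** (2008) 293–400,
§0 "Categories", kurims text p. 15 (totally epimorphic) and p. 18 ("an isomorphism is always a mono-minimal
categorical quotient of its domain by the trivial group") [cite: MochizukiFrdI2008, §0 p.18].

Companion to `CategoriesMonoMinimalSplitMono.lean` (abc-iut cell, block F, seat abc-iut-f-014), which proves
that the printed sentence holds for every isomorphism of a category `C` iff every split monomorphism of `C` is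
invertible (`forall_isMonoMinimalQuotient_bot_iff`). THIS FILE supplies the separating WITNESS showing that
this exact condition is strictly weaker than print's standing hypothesis "totally epimorphic": the
three-object category `W₃` (objects `a, b, c`; one arrow `f : a ⟶ b`, two parallel arrows `g ≠ h : b ⟶ c`,
one arrow `a ⟶ c`, so `f ≫ g = f ≫ h`) has a non-epic arrow (`W₃.not_epi_f`, `W₃.not_isTotallyEpimorphic`)
but no arrow backwards and no non-identity endomorphism, hence no non-invertible split monomorphism
(`W₃.isIso_of_isSplitMono`); `exists_splitMonoRigid_not_isTotallyEpimorphic` packages the separation.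
One inductive type of objects, its hom-types / composition (definitions) and the `Category` instance, all laws
by computation. Elementary; nothing here bears on [IUTchIII] Cor. 3.12; no statement of the paper is
strengthened or weakened.
-/

namespace Literature.AlgebraicGeometry.Frobenioids

open CategoryTheory

/-- The three-object category `W₃` separating split-mono-rigidity from total epimorphicity: objects
`a, b, c`; one arrow `f : a ⟶ b`, two parallel arrows `b ⟶ c` (indexed by `Bool`), one arrow `a ⟶ c`
(so `f ≫ g = f ≫ h` for the two parallel arrows `g ≠ h`: `f` is not epi); no arrows backwards and no
non-identity endomorphisms. [cite: MochizukiFrdI2008, §0 p.18] -/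
inductive W₃ : Type
  | a | b | c

namespace W₃

/-- Hom-types of `W₃`: `b ⟶ c` has two arrows (`Bool`); `a ⟶ b`, `a ⟶ c` and the endomorphism types have
one (`Unit`); the rest are empty. [cite: MochizukiFrdI2008, §0 p.18] -/
def HomT : W₃ → W₃ → Type
  | a, a => Unit
  | b, b => Unit
  | c, c => Unit
  | a, b => Unit
  | a, c => Unit
  | b, c => Bool
  | b, a => Empty
  | c, a => Empty
  | c, b => Empty

/-- Composition in `W₃` (forced: identities act trivially and the only composable pair of non-identity
arrows `a ⟶ b ⟶ c` lands in the one-element type `a ⟶ c`). [cite: MochizukiFrdI2008, §0 p.18] -/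
def compT : ∀ {X Y Z : W₃}, HomT X Y → HomT Y Z → HomT X Z
  | a, a, _, _, g => g
  | b, b, _, _, g => g
  | c, c, _, _, g => g
  | a, b, b, f, _ => f
  | a, b, c, _, _ => ()
  | a, c, c, f, _ => f
  | b, c, c, f, _ => f
  | a, b, a, _, g => g.elim
  | a, c, a, _, g => g.elim
  | a, c, b, _, g => g.elim
  | b, c, a, _, g => g.elim
  | b, c, b, _, g => g.elim
  | b, a, _, f, _ => f.elim
  | c, a, _, f, _ => f.elim
  | c, b, _, f, _ => f.elim

/-- `W₃` is a category (all laws hold by computation). [cite: MochizukiFrdI2008, §0 p.18] -/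
instance instCategory : Category W₃ where
  Hom := HomT
  id X := match X with | a => () | b => () | c => ()
  comp f g := compT f g
  id_comp {X Y} f := by cases X <;> cases Y <;> rfl
  comp_id {X Y} f := by cases X <;> cases Y <;> first | rfl | exact f.elim
  assoc {W X Y Z} f g h := by
    cases W <;> cases X <;> first | exact f.elim | (cases Y <;> first | exact g.elim | (cases Z <;> rfl))

/-- The arrow `f : a ⟶ b`. [cite: MochizukiFrdI2008, §0 p.18] -/
def f : a ⟶ b := ()

/-- The two parallel arrows `b ⟶ c`. [cite: MochizukiFrdI2008, §0 p.18] -/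
def par (t : Bool) : b ⟶ c := t

/-- Reading an arrow `b ⟶ c` back as a Boolean. [cite: MochizukiFrdI2008, §0 p.18] -/
def toBool (g : b ⟶ c) : Bool := g

/-- The two parallel arrows are distinct … [cite: MochizukiFrdI2008, §0 p.18] -/
theorem par_ne : par true ≠ par false := fun h => Bool.false_ne_true (congrArg toBool h).symm

/-- … but are equalised by `f`: `f` is not an epimorphism. [cite: MochizukiFrdI2008, §0 p.15] -/
theorem not_epi_f : ¬ Epi f := by
  intro h
  have key : f ≫ par true = f ≫ par false := rfl
  exact par_ne (h.left_cancellation _ _ key)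

/-- `W₃` is not totally epimorphic. [cite: MochizukiFrdI2008, §0 p.15] -/
theorem not_isTotallyEpimorphic : ¬ IsTotallyEpimorphic W₃ := fun h => not_epi_f (h.epi f)

/-- In `W₃` a split monomorphism is an endomorphism (there are no arrows backwards), hence the identity,
hence invertible. [cite: MochizukiFrdI2008, §0 p.18] -/
theorem isIso_of_isSplitMono {X Y : W₃} (ζ : X ⟶ Y) [IsSplitMono ζ] : IsIso ζ := by
  have ρ : Y ⟶ X := retraction ζ
  cases X <;> cases Y <;>
    first
    | exact (show Empty from ρ).elim
    | exact (show Empty from ζ).elim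
    | exact ⟨⟨𝟙 _, rfl, rfl⟩⟩

end W₃

/-- **Separation**: there is a category in which every split monomorphism is invertible — so, by
`forall_isMonoMinimalQuotient_bot_iff`, every isomorphism IS a mono-minimal categorical quotient of its
domain by the trivial group — which is NOT totally epimorphic: the printed sufficient condition of [FrdI] §0
p. 18 is not necessary. [cite: MochizukiFrdI2008, §0 p.18] -/
theorem exists_splitMonoRigid_not_isTotallyEpimorphic :
    ∃ (W : Type) (_ : Category.{0} W),
      (∀ ⦃A B : W⦄ (φ : A ⟶ B), IsIso φ → IsMonoMinimalQuotient (⊥ : Subgroup (Aut A)) φ) ∧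
        ¬ IsTotallyEpimorphic W :=
  ⟨W₃, inferInstance, (forall_isMonoMinimalQuotient_bot_iff W₃).mpr fun _ _ ζ _ => W₃.isIso_of_isSplitMono ζ,
    W₃.not_isTotallyEpimorphic⟩

end Literature.AlgebraicGeometry.Frobenioids
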